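import Mathlib
import Literature.MathematicalPhysics.QuantumFieldTheory.Balaban1983to89.T4EtaRateMin
import Literature.MathematicalPhysics.QuantumFieldTheory.Balaban1983to89.T4OutputRate

/-!
# T4RateLiaison — kernel glue for the T4-DAG edge U1b → U3 (NO NEW QUOTATION; nothing about the audited construction asserted)

Cell pub-balaban, near-miss cell 7, T4 node DAG (record `t4/T4-DAG.md` v1 §5: row T4-U3.E lists «U1b.E (soft)» among
its inputs).  Unit b2b-balaban-pv25 (gen 3), self-proposed liaison item T4-U1b.S.  VALUE = typed glue between two
hypothesis-shape modules, NOT summit progress.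

WHAT THIS MODULE IS.  Node U1b's output shape is `T4EtaRateMin.LocalRate R C θ` (consecutive runs' local readings of
the SAME unit-lattice datum differ by at most `C θ^K` at every site; NOT PRINTED for Bałaban's minimisers — see that
module's docstring and cell GAPS G-t4-U1b-1).  Node U3's input shape is `T4OutputRate.BackgroundsClose uA uB δ` (the
two runs' backgrounds driven by the same datum are `δ`-close in run A's gauge after transporting run B's), consumed by
`T4OutputRate.u3_geometric` through its premise `ha : CU · δ ≤ a · θ^{scale X}`.  Both cross-reads of the two modules
(GAPS C-pv25g3-6 (d), C-pv05g4-8 (d)) state the dictionary between them IN WORDS; here it is kernel-checked: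

* `GaugeDominated` — the one UNPRINTED realisation convention needed (data + an inequality, a `def … : Prop`, never
  asserted): at run level `K` the datum `v` drives a run-A background `uA K v` and a run-B background `uB K v`, and
  run A's closeness gauge of the pair is dominated by every uniform bound of the site discrepancies of the local
  readings `|R.loc (K+1) v x − R.loc K v x|` (the gauge of p. 263 of [I] is a sup of local quantities; which local
  quantities is node U1a's unprinted convention, GAPS G-t4-U1a-2 — this module does not choose them).
* `backgroundsClose_of_localRate` — (L1) `LocalRate R C θ` + `GaugeDominated` ⟹ `BackgroundsClose` on `↥R.dom` with
  `δ = C θ^K`, for every run level `K`.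
* `argumentBracket_le` — (L2) the `u3_geometric` premise `ha` from `δ = C θ^K` with `a := C · CU` at every creation
  scale `j ≤ K` (slack `θ^{K−j}`, using only `0 ≤ θ ≤ 1`).
* `u3_of_localRate` — (L3) the composite: T4OutputRate's three hypothesis shapes (NE9, Lipschitz-in-U, NE5) + node U2's
  coupling bracket `hb` + `LocalRate` + `GaugeDominated` give the carver's target shape
  `|E^{(j),A}(X; g^A, u^A_K v) − E^{(j+1),B}(X; g^B, u^B_K v)| ≤ (C·C_U + b + C₅) θ^j e^{−κ d_j(X)}` for every domain `X`
  created at a scale `j ≤ K` — every located input visible as a hypothesis, nothing else used.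

INDEXING REMARK (recorded for the carver; informational).  In the inductive form (0.24)–(0.25) p. 257 of [I] all terms of
the K-step action are evaluated at the K-level background, so the pair compared inside a scale-`j` term of run A (K steps,
spacing ε) and the scale-`(j+1)` term of run B (K+1 steps, spacing ε/L) is the level-`K` / level-`(K+1)` pair and the
η-rate enters as `θ^K ≤ θ^j`; were the terms instead evaluated at creation-level backgrounds, the index in (L1) would be
the creation scale `j` itself and (L2) would hold with no slack.  Either reading is an instance of (L3) (take `K := j`).

SCOPE / HONEST LIMITS.  No statement about Bałaban's or King's constructions is asserted; `LocalRate`,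
`GaugeDominated`, `NE9`, `LipBackground`, `NE5` and the coupling bracket are HYPOTHESES (binders).  An instance of
`GaugeDominated` forces the site type `X` to be nonempty whenever `R.dom` is (the gauge is nonnegative) — intended.
Everything here is `[folklore]` bookkeeping; zero `sorry`, no new axioms.

References (context only, nothing quoted): [I] = T. Bałaban, Renormalization group approach to lattice gauge field
theories. I, Commun. Math. Phys. 109 (1987) 249–301 [cite: Balaban1987RG1]; C. King, The U(1) Higgs model. I. The
continuum limit, Commun. Math. Phys. 102 (1986) 649–677 — Prop. 3.8 (3.71) p. 664 is the printed linear TEMPLATE of an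
η-rate (module `T4EtaRateMin`) [cite: King1986].
-/

namespace Literature.MathematicalPhysics.QuantumFieldTheory.Balaban1983to89.T4RateLiaison

open Literature.MathematicalPhysics.QuantumFieldTheory.Balaban1983to89.T4EtaRateMin (Readings LocalRate)
open Literature.MathematicalPhysics.QuantumFieldTheory.Balaban1983to89.T4OutputRate
  (Carriers Functional BackgroundsClose NE9 LipBackground NE5 u3_geometric)

-- `T4OutputRate.BackgroundsClose` quantifies its data type in `Type`; the data and site types are taken there too.
variable {ι X : Type} {Car : Carriers}

/-- REALISATION CONVENTION (UNPRINTED; data + one inequality, never asserted): at run level `K` the unit-lattice datum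
`v` drives the run-A background `uA K v` (spacing `L^{-K}`) and the run-B background `uB K v` (spacing `L^{-K-1}`),
and run A's closeness gauge of the pair — after transporting run B's background — is dominated by every uniform bound
of the site discrepancies of the local readings of the two runs.  (The gauge of p. 263 of [I] is a sup of local
quantities; WHICH local quantities is node U1a's unprinted convention, cell GAPS G-t4-U1a-2.) [folklore] -/
def GaugeDominated (R : Readings ι X) (uA : ℕ → ι → Car.BgA) (uB : ℕ → ι → Car.BgB) : Prop :=
  ∀ K : ℕ, ∀ v ∈ R.dom, ∀ M : ℝ, (∀ x : X, |R.loc (K + 1) v x - R.loc K v x| ≤ M) →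
    Car.gauge (uA K v) (Car.transport (uB K v)) ≤ M

/-- (L1) Node U1b's `LocalRate` with constant `C` and rate `θ`, realised through `GaugeDominated`, gives node U3's
`BackgroundsClose` on the admissible data with `δ = C θ^K`, at every run level `K`. [folklore] -/
theorem backgroundsClose_of_localRate {R : Readings ι X} {C θ : ℝ} (h : LocalRate R C θ)
    {uA : ℕ → ι → Car.BgA} {uB : ℕ → ι → Car.BgB} (hg : GaugeDominated R uA uB) (K : ℕ) :
    BackgroundsClose (C := Car) (fun v : R.dom => uA K v) (fun v : R.dom => uB K v) (C * θ ^ K) := by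
  intro v
  exact hg K v v.2 (C * θ ^ K) (fun x => h K v v.2 x)

/-- (L1′) Pointwise form of (L1) for one admissible datum. [folklore] -/
theorem gauge_le_of_localRate {R : Readings ι X} {C θ : ℝ} (h : LocalRate R C θ)
    {uA : ℕ → ι → Car.BgA} {uB : ℕ → ι → Car.BgB} (hg : GaugeDominated R uA uB) (K : ℕ) {v : ι} (hv : v ∈ R.dom) :
    Car.gauge (uA K v) (Car.transport (uB K v)) ≤ C * θ ^ K :=
  hg K v hv (C * θ ^ K) (fun x => h K v hv x)

/-- (L2) The argument-bracket premise `ha` of `T4OutputRate.u3_geometric` from `δ = C θ^K`: at every creation scale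
`j ≤ K`, `CU · (C θ^K) ≤ (C · CU) · θ^j` — slack `θ^{K-j}`, using only `0 ≤ θ ≤ 1`, `0 ≤ C`, `0 ≤ CU`. [folklore] -/
theorem argumentBracket_le {C θ CU : ℝ} (hC : 0 ≤ C) (hθ0 : 0 ≤ θ) (hθ1 : θ ≤ 1) (hCU : 0 ≤ CU) {j K : ℕ}
    (hjK : j ≤ K) : CU * (C * θ ^ K) ≤ C * CU * θ ^ j := by
  have hpow : θ ^ K ≤ θ ^ j := pow_le_pow_of_le_one hθ0 hθ1 hjK
  calc CU * (C * θ ^ K) = C * CU * θ ^ K := by ring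
    _ ≤ C * CU * θ ^ j := mul_le_mul_of_nonneg_left hpow (mul_nonneg hC hCU)

/-- (L3) COMPOSITE for the DAG edge U1b → U3: T4OutputRate's three hypothesis shapes on the output functionals (NE9,
Lipschitz-in-U on run A, NE5), node U2's coupling bracket at the scale of `X` (`hb`), node U1b's `LocalRate` and the
realisation convention `GaugeDominated` give the carver's target shape for every domain `X` created at a scale
`j = scale X ≤ K`, with `E₀′ = C·C_U(g^A, j) + b + C₅`.  Two modules' words made kernel glue; nothing else is used.
[folklore] -/
theorem u3_of_localRate {R : Readings ι X} {C θ : ℝ} (hloc : LocalRate R C θ) (hC : 0 ≤ C) (hθ0 : 0 ≤ θ)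
    (hθ1 : θ ≤ 1) {uA : ℕ → ι → Car.BgA} {uB : ℕ → ι → Car.BgB} (hg : GaugeDominated R uA uB)
    {W : Set (ℕ → ℝ)} {EA : Functional Car Car.BgA} {EB : Functional Car Car.BgB}
    {κ C₅ : ℝ} {Λ : ℕ → ℕ → ℝ} {CU : (ℕ → ℝ) → ℕ → ℝ}
    (h9 : NE9 EA W κ Λ) (hU : LipBackground EA W κ CU) (h5 : NE5 EA EB W κ θ C₅)
    {gA gB : ℕ → ℝ} (hgA : gA ∈ W) (hgB : gB ∈ W)
    (K : ℕ) {v : ι} (hv : v ∈ R.dom) (Xd : Car.Dom) (hjK : Car.scale Xd ≤ K) (hCU : 0 ≤ CU gA (Car.scale Xd))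
    {b : ℝ} (hb : (∑ i ∈ Finset.range (Car.scale Xd), Λ (Car.scale Xd) i * |gA i - gB i|) ≤ b * θ ^ Car.scale Xd) :
    |EA gA (uA K v) Xd - EB gB (uB K v) Xd| ≤
      (C * CU gA (Car.scale Xd) + b + C₅) * θ ^ Car.scale Xd * Real.exp (-(κ * Car.d Xd)) :=
  u3_geometric h9 hU h5 hgA hgB (gauge_le_of_localRate hloc hg K hv) Xd hCU
    (argumentBracket_le hC hθ0 hθ1 hCU hjK) hb

/-- (L3′) The creation-level reading of the INDEXING REMARK: with `K := scale X` there is no slack. [folklore] -/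
theorem u3_of_localRate_atScale {R : Readings ι X} {C θ : ℝ} (hloc : LocalRate R C θ) (hC : 0 ≤ C) (hθ0 : 0 ≤ θ)
    (hθ1 : θ ≤ 1) {uA : ℕ → ι → Car.BgA} {uB : ℕ → ι → Car.BgB} (hg : GaugeDominated R uA uB)
    {W : Set (ℕ → ℝ)} {EA : Functional Car Car.BgA} {EB : Functional Car Car.BgB}
    {κ C₅ : ℝ} {Λ : ℕ → ℕ → ℝ} {CU : (ℕ → ℝ) → ℕ → ℝ}
    (h9 : NE9 EA W κ Λ) (hU : LipBackground EA W κ CU) (h5 : NE5 EA EB W κ θ C₅)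
    {gA gB : ℕ → ℝ} (hgA : gA ∈ W) (hgB : gB ∈ W)
    {v : ι} (hv : v ∈ R.dom) (Xd : Car.Dom) (hCU : 0 ≤ CU gA (Car.scale Xd))
    {b : ℝ} (hb : (∑ i ∈ Finset.range (Car.scale Xd), Λ (Car.scale Xd) i * |gA i - gB i|) ≤ b * θ ^ Car.scale Xd) :
    |EA gA (uA (Car.scale Xd) v) Xd - EB gB (uB (Car.scale Xd) v) Xd| ≤
      (C * CU gA (Car.scale Xd) + b + C₅) * θ ^ Car.scale Xd * Real.exp (-(κ * Car.d Xd)) :=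
  u3_of_localRate hloc hC hθ0 hθ1 hg h9 hU h5 hgA hgB (Car.scale Xd) hv Xd le_rfl hCU hb

end Literature.MathematicalPhysics.QuantumFieldTheory.Balaban1983to89.T4RateLiaison
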